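import Literature.Claims.NS.Chae2007
import Literature.Analysis.FluidPDE.BKMClassEnstrophyContinuity
import HarnessLib

/-!
# Claim skeleton (D-0090 NS-CLAIMS, C119): Permana–Ibrahim–Lathief, «Quantitative Resolution of Global
# Regularity for 3D Incompressible Navier-Stokes Equations: Explicit Geometric Depletion and Non-Local
# Alignment Rates» (Zenodo v1, 2026)

Typed skeleton of B. P. Permana, S. A. Ibrahim, H. A. Lathief (HIKAM Institute of Science and Research,
Surakarta), *Quantitative Resolution of Global Regularity for 3D Incompressible Navier-Stokes Equations:
Explicit Geometric Depletion and Non-Local Alignment Rates*, Zenodo concept doi:10.5281/zenodo.19582630,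
**version v1 = record 19582631** (created 2026-04-14, PDF dated 12 April 2026, 8 pp., PDF sha16
e99057ab464ac326; title and abstract word for word = SSRN 6557718), the TEXT OF RECORD fixed by the cell chair
(RULINGS v1.33 (1), 2026-08-27); bib key `Permana2026`; page files `run/shared/lean/pub/ns-claims/sources/
Permana2026/pages-v1/pNNN.txt` (PDF page = printed page; line numbers below are those files' lines), locators by
`ns-claims-lit-1` (LOCATORS.md 0567b553eea32d9b). UNREFEREED CLAIM under adjudication — NOTHING in this file
asserts a step: the paper's statements are `def … : Prop`; the only theorems are kernel relations (composition,
the Clay link, one weakening). Later versions (records only, not typed): v2 19584430 (hedged wording), v3 19632058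
(re-posed on `𝕋³`, still unconditional), v4 20049273 (2026-05-06) self-declared «conditional … contingent upon a
strict smallness condition on initial data» (p.1, p.8 l.76).

## The claimed statement (v1 has no numbered theorem; it is carried by these verbatim sentences)

* Abstract, p.1 l.9–10: «We present a rigorous mathematical framework demonstrating the global existence and
  smoothness of solutions to the 3D incompressible Navier-Stokes equations for smooth initial data with finite
  energy.» — l.20: «We integrate these robust bounds to explicitly satisfy the Beale-Kato-Majda (BKM) criterion.»
* §1 p.2 l.1–8: (1) `∂ₜu + (u·∇)u + ∇p = νΔu, ∇·u = 0` on `ℝ³ × [0,T)` (no force); «The global regularity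
  problem, which asks if u(t) remains smooth for all t ∈ [0,∞) for smooth initial data u₀ ∈ H^s(ℝ³) (s ≥ 1) …».
* §8.2 p.7 l.19–24: «We have presented a rigorous mathematical framework demonstrating that the 3D
  incompressible Navier-Stokes equations possess global smooth solutions in ℝ³. … resolves the specific
  Millennium Prize parameters.» (§8.1 p.7 l.4: `ν > 0` is required; l.5–17: whole space only.)

RENDERING (the cell's convention for «smooth `H^s` data / smooth solution on `[0,T)`», shared with C17 `Chae2007`,
C28b `Iotti2025`, C97 `PanPan2025`, C137 `LucardoOlivaes2026` — `lean search` done, vocabulary REUSED, nothing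
re-declared): data = `Chae2007.IsDatum` (smooth, divergence free, every derivative in `L²`: the `H^∞ ∩ C^∞`
sub-class of the printed `H^s`, `s ≥ 1`; it contains every Clay datum (4)); solutions = `Chae2007.IsLocalSolution ν T
v₀ u p` / `Chae2007.IsGlobalSolution ν v₀ u p` (classical unforced solution in the Beale–Kato–Majda class — the
class in which the BKM criterion the paper invokes (§6 p.5 l.51–58, [11]) is a theorem of the tree); «blow-up at
`T*`» = `Chae2007.BlowsUpAt`. TODO(general form): `H^s` data, `s ≥ 1`, and solutions merely «smooth» (the printed
chain is an a priori estimate in `E(t) = ‖ω(t)‖²_{L²}` and `‖ω‖_{L^∞}`, so the rendering does not move any locator).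

## Clay delta (reference `Literature.Claims.NS.ClayVariants`; inputs lit-1 LOCATORS §2)

Nearest Clay statement: (A) `ClayVariants.clayR3`. Δ1 domain `ℝ³` =; Δ2/Δ3 unforced, `ν > 0` (p.7 l.4) =; Δ4 data
«smooth … `u₀ ∈ H^s(ℝ³)`, `s ≥ 1`» / «finite energy» ⊋ Clay (4) — the claim admits MORE data (stronger); Δ5/Δ6
conclusion «u(t) remains smooth for all t ∈ [0,∞)», no pressure clause, no energy clause (7), no uniqueness —
rendered as a global solution of the BKM class, in which (6) holds and (7) follows from the tree's energy
inequality (`IsClassicalNSSolutionOn.bkm_energy_le`), so `clay_of_claimed : ClaimedTheorem → ClayVariants.clayR3.Regularity`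
is PROVED below (the argument of `Chae2007.clay_of_claimedNS`, existence half only); no «wrong problem» axis; Δ7
fixed `ν > 0`, constants `C_{ν,u₀}`, `κ(ν,E₀)`, `C_ν` =.

## ORDERED STEP INDEX (the order in which `claim_of_steps` consumes them = the printed chain, LOCATORS §1 end:
## Lemma 3.1 (7) p.3 → (20) → (21) → (22) → (23) → (24) → (25) → (26) → BKM p.5 l.52 / p.6 l.48–49)

* `Step_1` (p.2 l.5–8 with §6 p.5 l.51–52 «regularity is preserved on [0,T*)»): the local theory / maximal-time
  dichotomy the BKM argument runs on — REUSED BY NAME: `Chae2007.Step_1` (Kato's dichotomy in the class;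
  DISCHARGED in the tree, `Chae2007.step_1_holds`).
* `Step_2` (§6 p.5 l.51–58: «The BKM theorem [11] states that regularity is preserved on [0,T*) if and only if
  ∫₀^{T*}‖ω(·,t)‖_{L∞}dt < ∞») — REUSED BY NAME: `Chae2007.Step_2 = MajdaBertozzi2002_bkmAprioriH3` (DISCHARGED).
* `Step_3` (Lemma 3.1 (7) p.3 l.33–40, in the form consumed at (21) p.5 l.69–83): the depletion law
  `|⟨ξ, Sξ⟩| ≤ C_{ν,u₀}|ω|^{−1/2}`, i.e. `|Sω·ω| ≤ C_{ν,u₀}|ω|^{3/2}` pointwise, constant depending on `ν` and the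
  datum only; `Step_3loc` is the same with the printed proviso «for any localized region where |ω| ≫ 1» rendered
  as a threshold (`step_3loc_of_step_3`). (`Sω·ω = ⟨ω, ∇u ω⟩`: the antisymmetric part of `∇u` drops out.)
* `Step_4` ((20) p.5 l.59–68): the enstrophy identity `dE/dt + 2ν‖∇ω‖² = 2∫Sω·ω`, `E(t) = ‖ω(·,t)‖²_{L²}`, as a
  right derivative on `[0,T*)` with `E` continuous there (classical).
* `Step_5` ((21)–(22) p.5 l.69–83, p.6 l.1–9): «2∫Sω·ω ≤ 2C∫|ω|^{3/2}» and «By Gagliardo-Nirenberg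
  interpolation, we bound the L^{3/2} norm by the L² norm, absorbing the energy conservation bound
  ‖u‖²_{L²} ≤ E₀ into a constant κ(ν,E₀)»: `2∫Sω·ω − 2ν‖∇ω‖² ≤ κ(1 + E(t))` with `κ = κ(ν, E₀, C)`.
* `Step_6` ((22) ⇒ (23) p.6 l.7–13, «Integrating (22) over [0,t]»): abstract Grönwall grain.
* `Step_7` ((24) p.6 l.14–20, «logarithmic Brezis-Gallouet-Wainger (BGW) inequality [12]»):
  `‖ω(·,t)‖_{L∞} ≤ C_BGW ‖ω(·,t)‖_{H¹} √log(e + ‖ω(·,t)‖_{H²})`, universal constant, on `ℝ³`.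
* `Step_8` ((24) ⇒ (25) p.6 l.21–31, «By standard elliptic regularity, the H² norm of vorticity is controlled by
  the dissipation term»): the integrand replacement `C_BGW‖ω‖_{H¹}√log(e+‖ω‖_{H²}) ≤ C_BGW E^{1/2}√log(e + C_ν t)`.
* `Step_9` ((26) and p.6 l.43–49: «For any finite T* < ∞, the integral on the right-hand side is strictly finite
  … Thus, the accumulation of L∞ vorticity is universally finite, strictly satisfying the BKM criterion»): a
  continuous majorant of `‖ω(·,t)‖_∞` on `[0,T*]` makes the BKM integral `∫₀^{T*}‖ω‖_∞` finite (bookkeeping,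
  classical in the class).
* The energy bound «‖u‖²_{L²} ≤ E₀» invoked on p.6 l.2 is the tree THEOREM `Chae2007.step_3_holds`
  (`IsClassicalNSSolutionOn.bkm_energy_le`), used as such in the composition (not a step of this paper).
* Not on the path (LOCATORS §1): Lemma 2.1 (T3, (3)–(6) p.2–3), Lemma 4.1 (11)–(14) p.4, (15)–(16) p.4, §5
  (17)–(19) and Lemma 5.1 p.5 («fortifies» (7) in words only), §7 (positioning v. Tao 2016 [10]) — not typed.

COMPOSITION: proved as `claim_of_steps : Step_1 → … → Step_9 → ClaimedTheorem` (contradiction at a finite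
maximal time exactly as §6 prints it). Recorded, NOT adjudicated here (refuter/referee lanes): (7) is printed with
the proviso «|ω| ≫ 1» and is applied at every point in (21) (LOCATORS §4); (22) bounds an `L^{3/2}` norm on `ℝ³`
by the `L²` norm; (24) is quoted from the two-dimensional paper [12] with `H¹` in front of the logarithm; (25)
replaces `‖ω‖_{H²}` by `C_ν t`.

WHAT THIS IS NOT: not a claim about NS regularity or blow-up; not a claim about any author beyond the typed
locator.
-/

noncomputable section

open Set Function Filter MeasureTheory
open scoped Topology ENNReal NNReal ContDiff RealInnerProductSpace

namespace Literature.Claims.NS.Permana2026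

open Literature.Analysis.FluidPDE
open Literature.Claims.NS.Chae2007 (IsDatum IsLocalSolution IsGlobalSolution BlowsUpAt l2Norm)

/-! ### Vocabulary of the paper (§3 p.3, §6 pp.5–6), over the C17 rendering of data and solutions -/

/-- `E(t) = ‖ω(·,t)‖²_{L²}` (§6.1 p.5 l.60), `ω = curl u(t)`, as a real number (lower Lebesgue integral; finite in
the class, so no junk value is met there). [cite: Permana2026, §6.1 p.5 l.60] -/
def enstrophy (u : ℝ → EuclideanSpace ℝ (Fin 3) → EuclideanSpace ℝ (Fin 3)) (t : ℝ) : ℝ :=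
  (∫⁻ x, ‖curl (u t) x‖ₑ ^ 2).toReal

/-- `‖∇ω(·,t)‖²_{L²} = ∫ Σᵢ|∂ᵢω|²` (the dissipation term of (20) p.5), as a real number: the HILBERT–SCHMIDT
(Frobenius) square of the Jacobian `D(curl u(t))` (tree `frobeniusNormSq`, Majda–Bertozzi (1.29) `∫|∇v|²`) — the
quantity for which (20) is the classical identity (rev 2, grain note of `ns-claims-salvage-p1`, precedent C137
`SoloSalvageLucardoOlivaes2026Enstrophy`: with the operator norm the identity would be a strictly stronger
statement). [cite: Permana2026, (20) p.5] -/
def gradVortSq (u : ℝ → EuclideanSpace ℝ (Fin 3) → EuclideanSpace ℝ (Fin 3)) (t : ℝ) : ℝ :=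
  (∫⁻ x, ENNReal.ofReal (frobeniusNormSq (fderiv ℝ (curl (u t)) x))).toReal

/-- `‖∇²ω(·,t)‖²_{L²}` (the top-order part of «‖ω(·,t)‖_{H²}» in (24) p.6), as a real number (operator norm
of `D²(curl u(t))`; it enters only the INEQUALITIES (24)–(25), where the choice of tensor norm changes constants
only). [cite: Permana2026, (24) p.6] -/
def hessVortSq (u : ℝ → EuclideanSpace ℝ (Fin 3) → EuclideanSpace ℝ (Fin 3)) (t : ℝ) : ℝ :=
  (∫⁻ x, ‖iteratedFDeriv ℝ 2 (curl (u t)) x‖ₑ ^ 2).toReal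

/-- `‖ω(·,t)‖_{H¹} = (‖ω‖²_{L²} + ‖∇ω‖²_{L²})^{1/2}` ((24) p.6). [cite: Permana2026, (24) p.6] -/
def h1Vort (u : ℝ → EuclideanSpace ℝ (Fin 3) → EuclideanSpace ℝ (Fin 3)) (t : ℝ) : ℝ :=
  Real.sqrt (enstrophy u t + gradVortSq u t)

/-- `‖ω(·,t)‖_{H²} = (‖ω‖²_{L²} + ‖∇ω‖²_{L²} + ‖∇²ω‖²_{L²})^{1/2}` ((24) p.6). [cite: Permana2026, (24) p.6] -/
def h2Vort (u : ℝ → EuclideanSpace ℝ (Fin 3) → EuclideanSpace ℝ (Fin 3)) (t : ℝ) : ℝ :=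
  Real.sqrt (enstrophy u t + gradVortSq u t + hessVortSq u t)

/-- `‖ω(·,t)‖_{L∞}` (§6 p.5 l.52, (24)–(26) p.6), as a real number: `(⨆ₓ ‖ω(t,x)‖ₑ).toReal` (finite in the
class; the BKM integral itself is kept in the tree's `ℝ≥0∞` form, see `Step_9`). [cite: Permana2026, §6 p.5 l.52] -/
def supVort (u : ℝ → EuclideanSpace ℝ (Fin 3) → EuclideanSpace ℝ (Fin 3)) (t : ℝ) : ℝ :=
  (⨆ x, ‖curl (u t) x‖ₑ).toReal

/-- The vortex-stretching integral `∫_{ℝ³} (Sω·ω) dx` of (20)–(21) p.5: `Sω·ω = ⟨ω, ∇u ω⟩` (the antisymmetric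
part of `∇u` is orthogonal), `∇u ω = Du(x)[ω(x)]`. In the class the integrand is integrable (`∇u` bounded,
`ω ∈ L²`). [cite: Permana2026, (20)–(21) p.5] -/
def stretch (u : ℝ → EuclideanSpace ℝ (Fin 3) → EuclideanSpace ℝ (Fin 3)) (t : ℝ) : ℝ :=
  ∫ x, ⟪curl (u t) x, fderiv ℝ (u t) x (curl (u t) x)⟫

/-- `∫_{ℝ³} |ω|^{3/2} dx` (right-hand side of (21) p.5), as a real number (lower Lebesgue integral of
`‖ω‖^{3/2}`; junk value `0` if infinite — finiteness is part of what (21)–(22) assert, see `Step_5`).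
[cite: Permana2026, (21) p.5] -/
def vort32 (u : ℝ → EuclideanSpace ℝ (Fin 3) → EuclideanSpace ℝ (Fin 3)) (t : ℝ) : ℝ :=
  (∫⁻ x, ‖curl (u t) x‖ₑ ^ ((3:ℝ) / 2)).toReal

/-! ### The claimed statement -/

/-- **HEADLINE (v1 abstract p.1 l.9–10, §1 p.2 l.5–8, §8.2 p.7 l.19–21), as printed**: for the unforced system
(1) on `ℝ³` with `ν > 0`, every smooth finite-energy (`H^s`, `s ≥ 1`) divergence-free datum launches a solution
that «remains smooth for all t ∈ [0,∞)» — rendered: a global classical solution in the BKM class from every datum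
of `Chae2007.IsDatum`, for every `ν > 0` (existence only; no uniqueness is claimed).
[claim: Permana2026, status: disputed] -/
def ClaimedTheorem : Prop :=
  ∀ ν : ℝ, 0 < ν → ∀ v₀ : EuclideanSpace ℝ (Fin 3) → EuclideanSpace ℝ (Fin 3), IsDatum v₀ →
    ∃ (u : ℝ → EuclideanSpace ℝ (Fin 3) → EuclideanSpace ℝ (Fin 3)) (p : ℝ → EuclideanSpace ℝ (Fin 3) → ℝ),
      IsGlobalSolution ν v₀ u p

/-! ### The paper's steps (no assertion) -/

/-- **Step 1 — the local theory / maximal-time dichotomy the BKM argument runs on** (§1 p.2 l.5–8 «if u(t)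
remains smooth for all t ∈ [0,∞) for smooth initial data»; §6 p.5 l.51–52 «regularity is preserved on [0,T*)»):
REUSED BY NAME from C17 — `Chae2007.Step_1` (for every `ν ≥ 0` and datum: a global solution of the class, or a
finite maximal `T*` with a class solution on `[0,T*)` that blows up in `H³`; DISCHARGED, `Chae2007.step_1_holds`).
[cite: Permana2026, §6 p.5 l.51–52] -/
def Step_1 : Prop :=
  Chae2007.Step_1

/-- **Step 2 — the Beale–Kato–Majda criterion as invoked** (§6 p.5 l.51–58: «The BKM theorem [11] states that
regularity is preserved on [0,T*) if and only if ∫₀^{T*}‖ω(·,t)‖_{L∞}dt < ∞»; [11] = Beale–Kato–Majda 1984):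
REUSED BY NAME — `Chae2007.Step_2 = Literature.Analysis.FluidPDE.MajdaBertozzi2002_bkmAprioriH3` (finite BKM
integral on `[0,T)` ⇒ `Σ_{n≤3}∫‖Dⁿu(t)‖²` bounded on `[0,T)`; DISCHARGED, `MajdaBertozzi2002_bkmAprioriH3_holds`).
[cite: Permana2026, §6 p.5 l.51–58] -/
def Step_2 : Prop :=
  Chae2007.Step_2

/-- **Step 3 — Lemma 3.1 (Quantitative Directional Depletion), display (7) p.3 l.33–40, in the form consumed at
(21) p.5 l.69–83.** Printed: «Let θ(x,t) be the angle between ξ and the principal extensional eigenvector of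
S(x,t). For any localized region where |ω| ≫ 1, there exists a constant C_{ν,u₀} such that:
|cos θ(x,t)| ≤ C_{ν,u₀}|ω(x,t)|^{−1/2} (7) which implies |α(x,t)| ≤ C_{ν,u₀}|ω|^{−1/2}», `ξ = ω/|ω|`,
`α = ⟨ξ,Sξ⟩` (p.3 l.31–32); used on p.5 as «Applying the robust alignment bound |⟨ξ,Sξ⟩| ≤ C|ω|^{−1/2} derived in
Lemma 3.1 …: 2∫(Sω·ω)dx = 2∫|ω|²⟨ξ,Sξ⟩dx ≤ 2C∫|ω|^{3/2}dx», i.e. at EVERY point. TYPED (quantifier order as printed,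
constant depending on `ν` and the datum only): for `ν > 0` and a datum `v₀` there is `C ≥ 0` such that along
every class solution from `v₀`, at every `(t,x)`, `|⟨ω, ∇u ω⟩| ≤ C |ω|^{3/2}` (`= |ω|²·|α|`, with `Sω·ω = ⟨ω,∇u ω⟩`).
The printed justification (p.3 l.41–78: Biot–Savart near/far field, «Optimizing δ ≈ |ω|^{−1/4} establishes (7)»)
is recorded in LOCATORS §4, not typed. [claim: Permana2026, status: disputed] -/
def Step_3 : Prop :=
  ∀ ν : ℝ, 0 < ν → ∀ v₀ : EuclideanSpace ℝ (Fin 3) → EuclideanSpace ℝ (Fin 3), IsDatum v₀ →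
    ∃ C : ℝ, 0 ≤ C ∧ ∀ T : ℝ, 0 < T →
      ∀ (u : ℝ → EuclideanSpace ℝ (Fin 3) → EuclideanSpace ℝ (Fin 3)) (p : ℝ → EuclideanSpace ℝ (Fin 3) → ℝ),
        IsLocalSolution ν T v₀ u p → ∀ t ∈ Ico 0 T, ∀ x,
          |⟪curl (u t) x, fderiv ℝ (u t) x (curl (u t) x)⟫| ≤ C * ‖curl (u t) x‖ ^ ((3:ℝ) / 2)

/-- **Step 3, literal face with the proviso «|ω| ≫ 1»** (Lemma 3.1 (7) p.3 l.35–36: «For any localized region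
where |ω| ≫ 1, there exists a constant C_{ν,u₀} …»), rendered with an explicit threshold `M`: the same bound at
the points where `‖ω(t,x)‖ ≥ M`. `Step_3 → Step_3loc` (`step_3loc_of_step_3`); the composition consumes `Step_3`
because (21) applies the bound at every point (LOCATORS §4). [claim: Permana2026, status: disputed] -/
def Step_3loc : Prop :=
  ∀ ν : ℝ, 0 < ν → ∀ v₀ : EuclideanSpace ℝ (Fin 3) → EuclideanSpace ℝ (Fin 3), IsDatum v₀ →
    ∃ C M : ℝ, 0 ≤ C ∧ ∀ T : ℝ, 0 < T →
      ∀ (u : ℝ → EuclideanSpace ℝ (Fin 3) → EuclideanSpace ℝ (Fin 3)) (p : ℝ → EuclideanSpace ℝ (Fin 3) → ℝ),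
        IsLocalSolution ν T v₀ u p → ∀ t ∈ Ico 0 T, ∀ x, M ≤ ‖curl (u t) x‖ →
          |⟪curl (u t) x, fderiv ℝ (u t) x (curl (u t) x)⟫| ≤ C * ‖curl (u t) x‖ ^ ((3:ℝ) / 2)

/-- The global face implies the literal (thresholded) face of Lemma 3.1. [cite: Permana2026, Lemma 3.1 (7) p.3] -/
theorem step_3loc_of_step_3 (h : Step_3) : Step_3loc := by
  intro ν hν v₀ hv₀
  obtain ⟨C, hC0, hC⟩ := h ν hν v₀ hv₀
  exact ⟨C, 0, hC0, fun T hT u p hsol t ht x _ => hC T hT u p hsol t ht x⟩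

/-- **Step 4 — the enstrophy identity (20) p.5 l.59–68**: «Let E(t) = ‖ω(·,t)‖²_{L²}. The evolution of enstrophy
is: d/dt E(t) + 2ν‖∇ω‖²_{L²} = 2∫_{ℝ³}(Sω·ω)dx». TYPED for class solutions on `[0,T)` as: `E` is continuous on
`[0,T)` and has at every `t ∈ [0,T)` the right derivative `−2ν‖∇ω(t)‖² + 2∫⟨ω,∇u ω⟩` (classical in the class;
`Sω·ω = ⟨ω, ∇u ω⟩`). [claim: Permana2026, status: disputed] -/
def Step_4 : Prop :=
  ∀ ν : ℝ, 0 < ν → ∀ T : ℝ, 0 < T →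
    ∀ (v₀ : EuclideanSpace ℝ (Fin 3) → EuclideanSpace ℝ (Fin 3))
      (u : ℝ → EuclideanSpace ℝ (Fin 3) → EuclideanSpace ℝ (Fin 3)) (p : ℝ → EuclideanSpace ℝ (Fin 3) → ℝ),
      IsLocalSolution ν T v₀ u p →
      ContinuousOn (enstrophy u) (Ico 0 T) ∧
        ∀ t ∈ Ico 0 T, HasDerivWithinAt (enstrophy u)
          (-(2 * ν * gradVortSq u t) + 2 * stretch u t) (Ici t) t

/-- **Step 5 — (21)–(22) p.5 l.69–83, p.6 l.1–9**: «2∫(Sω·ω)dx = 2∫|ω|²⟨ξ,Sξ⟩dx ≤ 2C∫_{ℝ³}|ω|^{3/2}dx (21).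
By Gagliardo-Nirenberg interpolation, we bound the L^{3/2} norm by the L² norm, absorbing the energy conservation
bound ‖u‖²_{L²} ≤ E₀ into a constant κ(ν,E₀). Crucially, κ depends only on initial physical parameters.
d/dt E(t) ≤ κ(ν,E₀)(1 + E(t)) (22)». TYPED as the inequality these lines assert for the right-hand side of (20):
for `ν > 0`, `E₀ ≥ 0` and a depletion constant `C ≥ 0` there is `κ ≥ 0` such that along every class solution
with `‖u(t)‖²_{L²} ≤ E₀` obeying the pointwise law of `Step_3` with constant `C`,
`2∫⟨ω,∇u ω⟩ − 2ν‖∇ω‖² ≤ κ(1 + E(t))` at every `t ∈ [0,T)`. [claim: Permana2026, status: disputed] -/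
def Step_5 : Prop :=
  ∀ ν : ℝ, 0 < ν → ∀ E₀ : ℝ, 0 ≤ E₀ → ∀ C : ℝ, 0 ≤ C → ∃ κ : ℝ, 0 ≤ κ ∧ ∀ T : ℝ, 0 < T →
    ∀ (v₀ : EuclideanSpace ℝ (Fin 3) → EuclideanSpace ℝ (Fin 3))
      (u : ℝ → EuclideanSpace ℝ (Fin 3) → EuclideanSpace ℝ (Fin 3)) (p : ℝ → EuclideanSpace ℝ (Fin 3) → ℝ),
      IsLocalSolution ν T v₀ u p → (∀ t ∈ Ico 0 T, l2Norm (u t) ^ 2 ≤ E₀) →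
      (∀ t ∈ Ico 0 T, ∀ x,
        |⟪curl (u t) x, fderiv ℝ (u t) x (curl (u t) x)⟫| ≤ C * ‖curl (u t) x‖ ^ ((3:ℝ) / 2)) →
      ∀ t ∈ Ico 0 T, 2 * stretch u t - 2 * ν * gradVortSq u t ≤ κ * (1 + enstrophy u t)

/-- **Step 6 — (22) ⇒ (23) p.6 l.7–13**: «Integrating (22) over [0,t] yields an exponential bound independent of
any presumed T*: E(t) ≤ (E(0) + 1)e^{κ(ν,E₀)t} − 1 (23)». TYPED at the abstract Grönwall grain the sentence
invokes: a function continuous on `[0,T)` with right derivative `≤ κ(1 + E)`, `κ ≥ 0`, obeys (23) on `[0,T)`.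
[claim: Permana2026, status: disputed] -/
def Step_6 : Prop :=
  ∀ (κ T : ℝ), 0 ≤ κ → 0 < T → ∀ E : ℝ → ℝ, ContinuousOn E (Ico 0 T) →
    (∀ t ∈ Ico 0 T, ∃ D : ℝ, HasDerivWithinAt E D (Ici t) t ∧ D ≤ κ * (1 + E t)) →
    ∀ t ∈ Ico 0 T, E t ≤ (E 0 + 1) * Real.exp (κ * t) - 1

/-- **Step 7 — the «logarithmic Brezis–Gallouet–Wainger inequality» (24) p.6 l.14–20**: «‖ω(·,t)‖_{L∞} ≤
C_BGW ‖ω(·,t)‖_{H¹} √(log(e + ‖ω(·,t)‖_{H²})) (24)» ([12] = Brezis–Gallouet 1980), on `ℝ³`, universal constant,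
applied to the vorticity of class solutions at every time. [claim: Permana2026, status: disputed] -/
def Step_7 : Prop :=
  ∃ C_BGW : ℝ, 0 < C_BGW ∧ ∀ ν : ℝ, 0 < ν → ∀ T : ℝ, 0 < T →
    ∀ (v₀ : EuclideanSpace ℝ (Fin 3) → EuclideanSpace ℝ (Fin 3))
      (u : ℝ → EuclideanSpace ℝ (Fin 3) → EuclideanSpace ℝ (Fin 3)) (p : ℝ → EuclideanSpace ℝ (Fin 3) → ℝ),
      IsLocalSolution ν T v₀ u p → ∀ t ∈ Ico 0 T,
        supVort u t ≤ C_BGW * h1Vort u t * Real.sqrt (Real.log (Real.exp 1 + h2Vort u t))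

/-- **Step 8 — (24) ⇒ (25) p.6 l.21–31**: «By standard elliptic regularity, the H² norm of vorticity is controlled
by the dissipation term. Squaring (24) and integrating over the interval [0,T*):
∫₀^{T*}‖ω(·,t)‖_{L∞}dt ≤ C_BGW ∫₀^{T*} E(t)^{1/2} √(log(e + C_ν t)) dt (25)». TYPED as the integrand replacement
the passage performs: for `ν > 0` there is `C_ν ≥ 0` with `‖ω‖_{H¹}√log(e + ‖ω‖_{H²}) ≤ E^{1/2}√log(e + C_ν t)`
along every class solution at every `t ∈ [0,T)`. [claim: Permana2026, status: disputed] -/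
def Step_8 : Prop :=
  ∀ ν : ℝ, 0 < ν → ∃ Cν : ℝ, 0 ≤ Cν ∧ ∀ T : ℝ, 0 < T →
    ∀ (v₀ : EuclideanSpace ℝ (Fin 3) → EuclideanSpace ℝ (Fin 3))
      (u : ℝ → EuclideanSpace ℝ (Fin 3) → EuclideanSpace ℝ (Fin 3)) (p : ℝ → EuclideanSpace ℝ (Fin 3) → ℝ),
      IsLocalSolution ν T v₀ u p → ∀ t ∈ Ico 0 T,
        h1Vort u t * Real.sqrt (Real.log (Real.exp 1 + h2Vort u t)) ≤
          Real.sqrt (enstrophy u t) * Real.sqrt (Real.log (Real.exp 1 + Cν * t))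

/-- **Step 9 — (26) and the closing sentences p.6 l.32–49**: «Substituting the explicit bound (23) into (25): …
(26). For any finite T* < ∞, the integral on the right-hand side is strictly finite because the exponential and
logarithmic functions are continuous and bounded on closed intervals. … Thus, the accumulation of L∞ vorticity is
universally finite, strictly satisfying the BKM criterion.» TYPED as the bookkeeping it asserts, in the tree's
form of the BKM integral (`∫⁻_{(0,T)} ⨆ₓ ‖curl u(t,x)‖ₑ`, as in `Step_2`): a majorant of `‖ω(·,t)‖_∞` continuous on
`[0,T]` makes the BKM integral over `(0,T)` finite (classical in the class, where `⨆ₓ‖ω‖ₑ < ∞` at each time).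
[claim: Permana2026, status: disputed] -/
def Step_9 : Prop :=
  ∀ ν : ℝ, 0 < ν → ∀ T : ℝ, 0 < T →
    ∀ (v₀ : EuclideanSpace ℝ (Fin 3) → EuclideanSpace ℝ (Fin 3))
      (u : ℝ → EuclideanSpace ℝ (Fin 3) → EuclideanSpace ℝ (Fin 3)) (p : ℝ → EuclideanSpace ℝ (Fin 3) → ℝ),
      IsLocalSolution ν T v₀ u p → ∀ F : ℝ → ℝ, ContinuousOn F (Icc 0 T) →
      (∀ t ∈ Ico 0 T, supVort u t ≤ F t) →
      (∫⁻ t in Ioo 0 T, ⨆ x, ‖curl (u t) x‖ₑ) < ⊤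

/-! ### Kernel relations: composition (the printed logic composes) and the Clay link -/

/-- **Composition — Steps 1–9 in the printed order give the headline.** Fix `ν > 0` and a datum `v₀`. `Step_1`:
either a global class solution exists (done), or there is a finite maximal `T*` with a class solution on `[0,T*)`
blowing up in `H³`. On `[0,T*)`: the energy bound `‖u(t)‖_{L²} ≤ ‖v₀‖_{L²}` (p.6 l.2; tree theorem
`Chae2007.step_3_holds`), the depletion constant `C = C_{ν,u₀}` (`Step_3`), `κ = κ(ν,E₀,C)` (`Step_5`), the
identity (20) (`Step_4`), hence `E′ ≤ κ(1+E)` and (23) by `Step_6`; (24) (`Step_7`) and (25) (`Step_8`) bound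
`‖ω(t)‖_∞` by the continuous `C_BGW √((E(0)+1)e^{κt}) √log(e + C_ν t)`; `Step_9` makes the BKM integral finite;
`Step_2` (BKM) bounds `Σ_{n≤3}∫‖Dⁿu(t)‖²` on `[0,T*)`, contradicting the blow-up. Pure logic otherwise; nothing is
asserted. [claim: Permana2026, status: disputed] -/
theorem claim_of_steps (h1 : Step_1) (h2 : Step_2) (h3 : Step_3) (h4 : Step_4) (h5 : Step_5) (h6 : Step_6)
    (h7 : Step_7) (h8 : Step_8) (h9 : Step_9) : ClaimedTheorem := by
  intro ν hν v₀ hv₀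
  rcases h1 ν hν.le v₀ hv₀ with hglob | ⟨T, hT, u, p, hsol, hblow⟩
  · exact hglob
  · exfalso
    -- energy bound (p.6 l.2), a tree theorem in the class
    have hE : ∀ t ∈ Ico 0 T, l2Norm (u t) ^ 2 ≤ l2Norm v₀ ^ 2 := fun t ht =>
      pow_le_pow_left₀ (Real.sqrt_nonneg _) (Chae2007.step_3_holds ν hν.le T hT v₀ u p hsol t ht) 2
    have hE₀ : 0 ≤ l2Norm v₀ ^ 2 := sq_nonneg _
    -- Lemma 3.1 constant and κ(ν, E₀, C)
    obtain ⟨C, hC0, hC⟩ := h3 ν hν v₀ hv₀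
    have hα := hC T hT u p hsol
    obtain ⟨κ, hκ0, hκ⟩ := h5 ν hν (l2Norm v₀ ^ 2) hE₀ C hC0
    have h22 : ∀ t ∈ Ico 0 T, 2 * stretch u t - 2 * ν * gradVortSq u t ≤ κ * (1 + enstrophy u t) :=
      hκ T hT v₀ u p hsol hE hα
    -- (20) and (23)
    obtain ⟨hcont, hder⟩ := h4 ν hν T hT v₀ u p hsol
    have h23 : ∀ t ∈ Ico 0 T, enstrophy u t ≤ (enstrophy u 0 + 1) * Real.exp (κ * t) - 1 :=
      h6 κ T hκ0 hT (enstrophy u) hcont fun t ht =>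
        ⟨_, hder t ht, by linarith [h22 t ht]⟩
    -- (24)–(25): a continuous majorant of `‖ω(t)‖_∞` on `[0, T]`
    obtain ⟨CB, hCB, h24⟩ := h7
    obtain ⟨Cν, hCν0, h25⟩ := h8 ν hν
    set F : ℝ → ℝ := fun t =>
      CB * Real.sqrt ((enstrophy u 0 + 1) * Real.exp (κ * t)) *
        Real.sqrt (Real.log (Real.exp 1 + Cν * t)) with hF
    have hFcont : ContinuousOn F (Icc 0 T) := by
      have c1 : Continuous fun t : ℝ => CB * Real.sqrt ((enstrophy u 0 + 1) * Real.exp (κ * t)) :=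
        continuous_const.mul (Real.continuous_sqrt.comp
          (continuous_const.mul (Real.continuous_exp.comp (continuous_const.mul continuous_id))))
      have c2 : ContinuousOn (fun t : ℝ => Real.sqrt (Real.log (Real.exp 1 + Cν * t))) (Icc 0 T) := by
        refine Real.continuous_sqrt.comp_continuousOn (ContinuousOn.log ?_ fun t ht => ?_)
        · exact (continuous_const.add (continuous_const.mul continuous_id)).continuousOn
        · have h1 : 0 < Real.exp 1 := Real.exp_pos 1
          have h2 : 0 ≤ Cν * t := mul_nonneg hCν0 ht.1
          exact ne_of_gt (by linarith)
      exact c1.continuousOn.mul c2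
    have hsup : ∀ t ∈ Ico 0 T, supVort u t ≤ F t := by
      intro t ht
      have ha := h24 ν hν T hT v₀ u p hsol t ht
      have hb := h25 T hT v₀ u p hsol t ht
      have hc : Real.sqrt (enstrophy u t) ≤ Real.sqrt ((enstrophy u 0 + 1) * Real.exp (κ * t)) :=
        Real.sqrt_le_sqrt (by linarith [h23 t ht])
      have hl0 : 0 ≤ Real.sqrt (Real.log (Real.exp 1 + Cν * t)) := Real.sqrt_nonneg _
      calc supVort u t ≤ CB * (h1Vort u t * Real.sqrt (Real.log (Real.exp 1 + h2Vort u t))) := by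
            rw [← mul_assoc]; exact ha
        _ ≤ CB * (Real.sqrt (enstrophy u t) * Real.sqrt (Real.log (Real.exp 1 + Cν * t))) :=
            mul_le_mul_of_nonneg_left hb hCB.le
        _ ≤ CB * (Real.sqrt ((enstrophy u 0 + 1) * Real.exp (κ * t)) *
              Real.sqrt (Real.log (Real.exp 1 + Cν * t))) :=
            mul_le_mul_of_nonneg_left (mul_le_mul_of_nonneg_right hc hl0) hCB.le
        _ = F t := by simp only [hF, mul_assoc]
    -- (26): the BKM integral is finite; BKM contradicts the blow-up at `T*`
    have hBKM := h9 ν hν T hT v₀ u p hsol F hFcont hsup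
    exact hblow (h2 hν.le hT hsol.isClassical hsol.sobolev hBKM)

/-- **`ClaimedTheorem` implies Clay (A)** (`Literature.Claims.NS.ClayVariants.clayR3.Regularity`, token for token
the summit body): a Clay datum (smooth, divergence free, rapid decay (4)) is a datum of the class (Schwartz ⇒
`H^∞`, tree `HasRapidSpatialDecay.lintegral_enorm_iteratedFDeriv_sq_lt_top`); the global solution of the class is
smooth on `ℝ³ × [0,∞)` with `u(0) = u₀` (bridge `isNavierStokesSolution_and_smooth_iff`), and the energy bound (7)
holds with `C = ∫|u₀|²` by the tree's energy inequality in the BKM class (`IsClassicalNSSolutionOn.bkm_energy_le`).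
The argument is `Chae2007.clay_of_claimedNS` (existence half). No «wrong problem» axis.
[cite: FeffermanClay2006, statement (A), CMI offprint p. 2] -/
theorem clay_of_claimed (h : ClaimedTheorem) : ClayVariants.clayR3.Regularity := by
  intro ν hν u₀ hu₀ hdiv hdecay
  have hdat : IsDatum u₀ :=
    ⟨hu₀, fun x => hdiv x, fun n => hdecay.lintegral_enorm_iteratedFDeriv_sq_lt_top n⟩
  obtain ⟨u, p, hsol⟩ := h ν hν u₀ hdat
  obtain ⟨hns, hsu, hsp⟩ :=
    (isNavierStokesSolution_and_smooth_iff (ν := ν) (f := 0) (u₀ := u₀) (u := u) (p := p)).2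
      ⟨hsol.isClassical, hsol.initial⟩
  refine ⟨u, p, hsu, hsp, hns, ?_⟩
  show HasBoundedEnergy u
  have key : ∀ S : ℝ, 0 < S → ∀ τ ∈ Icc (0:ℝ) S,
      ∫⁻ x, ‖u τ x‖ₑ ^ 2 = ENNReal.ofReal (∫ x, ‖u τ x‖ ^ 2) := by
    intro S hS τ hτ
    have hcl : IsClassicalNSSolutionOn (Icc 0 S) ν 0 u p :=
      hsol.isClassical.mono Icc_subset_Ici_self (uniqueDiffOn_Icc hS)
    obtain ⟨C, hC⟩ := hsol.sobolev S 0
    have hfin0 : ∫⁻ x, ‖iteratedFDeriv ℝ 0 (u τ) x‖ₑ ^ 2 < ⊤ := (hC τ hτ).trans_lt ENNReal.coe_lt_top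
    have heq : (fun x => ‖iteratedFDeriv ℝ 0 (u τ) x‖ₑ ^ 2) = fun x => ‖u τ x‖ₑ ^ 2 := by
      funext x
      rw [← ofReal_norm, norm_iteratedFDeriv_zero, ofReal_norm]
    have hfin : ∫⁻ x, ‖u τ x‖ₑ ^ 2 < ⊤ := by rwa [heq] at hfin0
    have hint : Integrable (fun x => ‖u τ x‖ ^ 2) :=
      integrable_sq_norm_of_lintegral_lt_top (hcl.contDiff_velocity hτ).continuous hfin
    rw [ofReal_integral_eq_lintegral_ofReal hint (Eventually.of_forall fun x => sq_nonneg _)]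
    refine lintegral_congr fun x => ?_
    rw [← ofReal_norm, ENNReal.ofReal_pow (norm_nonneg _)]
  refine ⟨∫⁻ x, ‖u₀ x‖ₑ ^ 2, ?_, fun t ht => ?_⟩
  · have h0 := hdat.2.2 0
    have heq : (fun x => ‖iteratedFDeriv ℝ 0 u₀ x‖ₑ ^ 2) = fun x => ‖u₀ x‖ₑ ^ 2 := by
      funext x
      rw [← ofReal_norm, norm_iteratedFDeriv_zero, ofReal_norm]
    rwa [heq] at h0
  · have hT : (0:ℝ) < t + 1 := by linarith
    have hcl : IsClassicalNSSolutionOn (Icc 0 (t + 1)) ν 0 u p :=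
      hsol.isClassical.mono Icc_subset_Ici_self (uniqueDiffOn_Icc hT)
    have hE : ∫ x, ‖u t x‖ ^ 2 ≤ ∫ x, ‖u 0 x‖ ^ 2 :=
      hcl.bkm_energy_le hν.le hT (hsol.sobolev (t + 1)) ⟨ht, by linarith⟩
    rw [key (t + 1) hT t ⟨ht, by linarith⟩, ← hsol.initial, key (t + 1) hT 0 ⟨le_rfl, hT.le⟩]
    exact ENNReal.ofReal_le_ofReal hE

/-! ### Step 5 holds at the typed face (records-grade TRUE column; the located step is `Step_3`) -/

/-- **`Step_5` HOLDS** — (21)→(22) p.5 l.69–83 / p.6 l.1–8 at the TYPED face, with `κ := 2(C + 1)` and WITHOUT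
the printed «By Gagliardo-Nirenberg interpolation, we bound the L^{3/2} norm by the L² norm» sentence (not an
inequality on `ℝ³`) and without the energy bound `E₀`: granted the pointwise law of `Step_3` with constant `C`
along the flow, split at every `x` — where `‖ω‖ ≥ 1` the law gives `⟪ω, ∇u ω⟫ ≤ C‖ω‖^{3/2} ≤ C‖ω‖²`, where
`‖ω‖ < 1` Cauchy–Schwarz gives `⟪ω, ∇u ω⟫ ≤ ‖∇u‖‖ω‖² ≤ ‖∇u‖‖ω‖ ≤ (|∇u|²_F + ‖ω‖²)/2` — so
`⟪ω, ∇u ω⟫ ≤ C‖ω‖² + (|∇u|²_F + ‖ω‖²)/2` everywhere; integrate and use the `div`–`curl` bound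
`∫|∇u|²_F ≤ ∫‖ω‖²` of the tree (`lintegral_frobeniusNormSq_fderiv_le_lintegral_sq_norm_curl`, `u(t)` divergence
free and in `L²` in the class): `2∫⟨ω,∇u ω⟩ − 2ν‖∇ω‖² ≤ 2(C+1)E(t) ≤ 2(C+1)(1 + E(t))`. This is the referee's
charitable chain R3 («(22)–(23) follow from the threshold face of Lemma 3.1 without the Gagliardo–Nirenberg
step», `claims/Permana2026/RETYPE.md` §3) kernel-checked at the typed face: granted Lemma 3.1, display (22)
follows — Lemma 3.1 (7) p.3 is exactly load-bearing. [cite: Permana2026, (21)–(22) p.5 l.69–83, p.6 l.1–8] -/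
theorem step_5_holds : Step_5 := by
  intro ν hν E₀ _hE₀ C hC
  refine ⟨2 * (C + 1), by positivity, ?_⟩
  intro T _hT v₀ u p hsol _hE hlaw t ht
  -- the class at time `t`: `u(t)` smooth, divergence free, `u(t) ∈ L²`, `Du(t) ∈ L²`
  have hcl := hsol.isClassical
  have hsm : ContDiff ℝ ∞ (u t) := hcl.contDiff_velocity ht
  have hct2 : ContDiff ℝ 2 (u t) := hsm.of_le (by norm_cast)
  have hdiv : VectorCalculus.IsDivFree (u t) := hcl.divFree t ht
  have hB : HasBoundedSobolevNormsOn (Icc 0 t) u := hsol.sobolev t ht.2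
  have htI : t ∈ Icc 0 t := ⟨ht.1, le_rfl⟩
  obtain ⟨A₀, hA₀⟩ := hB 0
  obtain ⟨A₁, hA₁⟩ := hB 1
  have hL2 : ∫⁻ x, ‖u t x‖ₑ ^ 2 < ⊤ := by
    have h := hA₀ t htI
    simp only [norm_iteratedFDeriv_zero, ← ofReal_norm] at h ⊢
    exact h.trans_lt ENNReal.coe_lt_top
  have h1 : ∫⁻ x, ‖iteratedFDeriv ℝ 1 (u t) x‖ₑ ^ 2 < ⊤ := (hA₁ t htI).trans_lt ENNReal.coe_lt_top
  -- integrability of `‖ω‖²` and of `|∇u|²_F`, and `∫|∇u|²_F ≤ E(t) = ∫‖ω‖²`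
  have hintω : Integrable (fun x => ‖curl (u t) x‖ ^ 2) := (integrable_norm_curl_sq hct2 h1).1
  have hfrob_le : ∫⁻ x, ENNReal.ofReal (frobeniusNormSq (fderiv ℝ (u t) x)) ≤ ∫⁻ x, ‖curl (u t) x‖ₑ ^ 2 :=
    lintegral_frobeniusNormSq_fderiv_le_lintegral_sq_norm_curl hct2 hdiv hL2
  have hElin : ∫⁻ x, ‖curl (u t) x‖ₑ ^ 2 = ENNReal.ofReal (∫ x, ‖curl (u t) x‖ ^ 2) :=
    lintegral_enorm_curl_sq_eq_ofReal_integral hct2 h1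
  have hEfin : ∫⁻ x, ‖curl (u t) x‖ₑ ^ 2 < ⊤ := by rw [hElin]; exact ENNReal.ofReal_lt_top
  have hE_eq : enstrophy u t = ∫ x, ‖curl (u t) x‖ ^ 2 := by
    simp only [enstrophy]
    rw [hElin, ENNReal.toReal_ofReal (integral_nonneg fun _ => sq_nonneg _)]
  have hintF : Integrable (fun x => frobeniusNormSq (fderiv ℝ (u t) x)) := by
    refine ⟨(continuous_frobeniusNormSq_fderiv hsm (by simp)).aestronglyMeasurable, ?_⟩
    unfold HasFiniteIntegral
    calc ∫⁻ x, ‖frobeniusNormSq (fderiv ℝ (u t) x)‖ₑ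
        = ∫⁻ x, ENNReal.ofReal (frobeniusNormSq (fderiv ℝ (u t) x)) :=
          lintegral_congr fun x => Real.enorm_eq_ofReal (frobeniusNormSq_nonneg _)
      _ ≤ ∫⁻ x, ‖curl (u t) x‖ₑ ^ 2 := hfrob_le
      _ < ⊤ := hEfin
  have hF_le : ∫ x, frobeniusNormSq (fderiv ℝ (u t) x) ≤ enstrophy u t := by
    rw [integral_eq_lintegral_of_nonneg_ae (ae_of_all _ fun x => frobeniusNormSq_nonneg _)
      hintF.aestronglyMeasurable]
    exact ENNReal.toReal_mono hEfin.ne hfrob_le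
  have hens : 0 ≤ enstrophy u t := ENNReal.toReal_nonneg
  -- the pointwise majorant
  have hpt : ∀ x, ⟪curl (u t) x, fderiv ℝ (u t) x (curl (u t) x)⟫ ≤
      C * ‖curl (u t) x‖ ^ 2 + (frobeniusNormSq (fderiv ℝ (u t) x) + ‖curl (u t) x‖ ^ 2) / 2 := by
    intro x
    have hFx : ‖fderiv ℝ (u t) x‖ ^ 2 ≤ frobeniusNormSq (fderiv ℝ (u t) x) := sq_opNorm_le_frobeniusNormSq _
    have hcs : ⟪curl (u t) x, fderiv ℝ (u t) x (curl (u t) x)⟫ ≤ ‖fderiv ℝ (u t) x‖ * ‖curl (u t) x‖ ^ 2 :=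
      calc ⟪curl (u t) x, fderiv ℝ (u t) x (curl (u t) x)⟫
          ≤ ‖curl (u t) x‖ * ‖fderiv ℝ (u t) x (curl (u t) x)‖ := real_inner_le_norm _ _
        _ ≤ ‖curl (u t) x‖ * (‖fderiv ℝ (u t) x‖ * ‖curl (u t) x‖) := by
            gcongr; exact (fderiv ℝ (u t) x).le_opNorm _
        _ = ‖fderiv ℝ (u t) x‖ * ‖curl (u t) x‖ ^ 2 := by ring
    rcases le_or_gt 1 ‖curl (u t) x‖ with h1x | h1x
    · -- high vorticity: the depletion law
      have hrp : ‖curl (u t) x‖ ^ ((3:ℝ) / 2) ≤ ‖curl (u t) x‖ ^ 2 :=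
        calc ‖curl (u t) x‖ ^ ((3:ℝ) / 2) ≤ ‖curl (u t) x‖ ^ (2:ℝ) :=
              Real.rpow_le_rpow_of_exponent_le h1x (by norm_num)
          _ = ‖curl (u t) x‖ ^ 2 := Real.rpow_two _
      have hl := (le_abs_self _).trans (hlaw t ht x)
      linarith [mul_le_mul_of_nonneg_left hrp hC, frobeniusNormSq_nonneg (fderiv ℝ (u t) x),
        sq_nonneg ‖curl (u t) x‖]
    · -- low vorticity: Cauchy–Schwarz and `ab ≤ (a² + b²)/2`
      have hω1 : ‖curl (u t) x‖ ^ 2 ≤ ‖curl (u t) x‖ := by nlinarith [norm_nonneg (curl (u t) x)]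
      have ham : ‖fderiv ℝ (u t) x‖ * ‖curl (u t) x‖ ^ 2 ≤
          (‖fderiv ℝ (u t) x‖ ^ 2 + ‖curl (u t) x‖ ^ 2) / 2 := by
        nlinarith [mul_le_mul_of_nonneg_left hω1 (norm_nonneg (fderiv ℝ (u t) x)),
          sq_nonneg (‖fderiv ℝ (u t) x‖ - ‖curl (u t) x‖)]
      linarith [mul_nonneg hC (sq_nonneg ‖curl (u t) x‖)]
  -- integrate the majorant
  have hi1 : Integrable (fun x => C * ‖curl (u t) x‖ ^ 2) := hintω.const_mul C
  have hi2 : Integrable (fun x => (frobeniusNormSq (fderiv ℝ (u t) x) + ‖curl (u t) x‖ ^ 2) / 2) :=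
    (hintF.add hintω).div_const 2
  have hmaj : Integrable (fun x =>
      C * ‖curl (u t) x‖ ^ 2 + (frobeniusNormSq (fderiv ℝ (u t) x) + ‖curl (u t) x‖ ^ 2) / 2) :=
    hi1.add hi2
  have hstretch : stretch u t ≤ (C + 1) * enstrophy u t := by
    simp only [stretch]
    by_cases hint : Integrable (fun x => ⟪curl (u t) x, fderiv ℝ (u t) x (curl (u t) x)⟫)
    · calc ∫ x, ⟪curl (u t) x, fderiv ℝ (u t) x (curl (u t) x)⟫
          ≤ ∫ x, (C * ‖curl (u t) x‖ ^ 2 + (frobeniusNormSq (fderiv ℝ (u t) x) + ‖curl (u t) x‖ ^ 2) / 2) :=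
            integral_mono hint hmaj fun x => hpt x
        _ = C * (∫ x, ‖curl (u t) x‖ ^ 2) +
              ((∫ x, frobeniusNormSq (fderiv ℝ (u t) x)) + ∫ x, ‖curl (u t) x‖ ^ 2) / 2 := by
            rw [integral_add hi1 hi2, integral_const_mul, integral_div, integral_add hintF hintω]
        _ ≤ (C + 1) * enstrophy u t := by rw [← hE_eq]; nlinarith [hF_le, hens, hC]
    · rw [integral_undef hint]; positivity
  -- conclude: the dissipation term is nonpositive
  have hgvs : 0 ≤ gradVortSq u t := ENNReal.toReal_nonneg
  nlinarith [hstretch, mul_nonneg hν.le hgvs, hens, hC, mul_nonneg hC hens]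

/-! ### Step 3, class-uniform face (records-grade, for the repair census; the located step stays `Step_3`) -/

/-- **Step 3 — CLASS-UNIFORM face `Step_3cls` (the constant the printed PROOF produces, p.3 l.74–78)**: «Using the
Hardy-Littlewood-Sobolev inequality, the contribution is bounded by the uniformly finite L²-energy. Optimizing
δ ≈ |ω|^{−1/4} establishes (7) with the exponent α = 1/2» — a depletion constant depending on `ν` and the energy bound
ONLY (whereas the STATEMENT of Lemma 3.1, typed as `Step_3`, writes `C_{ν,u₀}`): for `ν > 0` and `E₀ ≥ 0` there is
`C ≥ 0` such that along EVERY class solution with `‖u(t)‖²_{L²} ≤ E₀` on `[0,T)`, at every `t` and `x`,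
`|⟪ω, ∇u ω⟫| ≤ C‖ω‖^{3/2}`. Typed at the request of the referee / chair for the repair census (ns-claims-ref-3
09:49:04Z (ii), 09:59:19Z; RULINGS 10:18Z (4)(a)); it implies the token face (`step_3_of_step_3cls`, energy decay) and
is NOT a binder of `claim_of_steps`. [claim: Permana2026, status: disputed] -/
def Step_3cls : Prop :=
  ∀ ν : ℝ, 0 < ν → ∀ E₀ : ℝ, 0 ≤ E₀ → ∃ C : ℝ, 0 ≤ C ∧ ∀ T : ℝ, 0 < T →
    ∀ (v₀ : EuclideanSpace ℝ (Fin 3) → EuclideanSpace ℝ (Fin 3))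
      (u : ℝ → EuclideanSpace ℝ (Fin 3) → EuclideanSpace ℝ (Fin 3)) (p : ℝ → EuclideanSpace ℝ (Fin 3) → ℝ),
      IsLocalSolution ν T v₀ u p → (∀ t ∈ Ico 0 T, l2Norm (u t) ^ 2 ≤ E₀) →
      ∀ t ∈ Ico 0 T, ∀ x,
        |⟪curl (u t) x, fderiv ℝ (u t) x (curl (u t) x)⟫| ≤ C * ‖curl (u t) x‖ ^ ((3:ℝ) / 2)

/-- The class-uniform face implies the token face: given a datum `v₀`, take `E₀ := ‖v₀‖²_{L²}`; along every class
solution from `v₀` the energy does not increase (`Chae2007.step_3_holds`, Majda–Bertozzi Prop. 3.1), so the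
class-uniform constant `C(ν, ‖v₀‖²)` serves as `C_{ν,u₀}`. (So a kill of `Step_3cls` documents the gap in the printed
proof without touching `Step_3`.) [cite: Permana2026, Lemma 3.1 (7) p.3 l.33–40 and l.74–78] -/
theorem step_3_of_step_3cls (h : Step_3cls) : Step_3 := by
  intro ν hν v₀ _hv₀
  obtain ⟨C, hC, hlaw⟩ := h ν hν (l2Norm v₀ ^ 2) (sq_nonneg _)
  refine ⟨C, hC, fun T hT u p hsol t ht x => hlaw T hT v₀ u p hsol (fun s hs => ?_) t ht x⟩
  have hle : l2Norm (u s) ≤ l2Norm v₀ := Chae2007.step_3_holds ν hν.le T hT v₀ u p hsol s hs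
  have h0 : 0 ≤ l2Norm (u s) := Real.sqrt_nonneg _
  exact pow_le_pow_left₀ h0 hle 2


/-! ### D-0026 in-file discharge of Steps 6 and 9 (records-grade TRUE column; the located step is `Step_3`) —
ns-claims-lit-2 g5, APPEND-ONLY below `step_3_of_step_3cls`; no statement / import touched. -/

/-- **`Step_6` HOLDS** — (22) ⇒ (23) p.6 l.7–13 at the TYPED Grönwall grain: a function `E` continuous on `[0,T)`
whose right derivative `D(t)` within `[t,∞)` satisfies `D(t) ≤ κ(1 + E(t))`, `κ ≥ 0`, obeys
`E(t) ≤ (E(0)+1)e^{κt} − 1` on `[0,T)`. Proof = Mathlib's Grönwall inequality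
`le_gronwallBound_of_liminf_deriv_right_le` on `[0,t]` with `δ := E(0)`, `K := κ`, `ε := κ` (the liminf of right
slopes at `x` is `≤ D(x)` by `HasDerivWithinAt.liminf_right_slope_le`), and `gronwallBound E(0) κ κ t =
E(0)e^{κt} + (κ/κ)(e^{κt} − 1)` (`κ ≠ 0`; the case `κ = 0` gives `E(t) ≤ E(0)`). Granted (22), display (23)
follows as printed. Summits-side twin (same statement, proved first): `Summit.NavierStokesRegularity.
NavierStokesRegularity.Theorems.Permana2026Salvage.step_6_holds` (Theorems/SoloSalvagePermana2026.lean) — restated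
here because `Literature` may not import `Summits`; this in-file copy is what retires the named fact `Step_6`.
[cite: Permana2026, (22)–(23) p.6 l.7–13] -/
theorem step_6_holds : Step_6 := by
  intro κ T _hκ _hT E hEc hD t ht
  -- choose the right derivatives along `[0,T)`
  choose! D hD' hDle using hD
  -- work on the closed interval `[0, t] ⊆ [0, T)`
  have hsub : Icc 0 t ⊆ Ico 0 T := fun s hs => ⟨hs.1, lt_of_le_of_lt hs.2 ht.2⟩
  have hcont : ContinuousOn E (Icc 0 t) := hEc.mono hsub
  have hderiv : ∀ x ∈ Ico 0 t, ∀ r, D x < r →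
      ∃ᶠ z in 𝓝[>] x, (z - x)⁻¹ * (E z - E x) < r := by
    intro x hx r hr
    have hxT : x ∈ Ico 0 T := ⟨hx.1, lt_trans hx.2 ht.2⟩
    have h := (hD' x hxT).liminf_right_slope_le hr
    refine h.mono fun z hz => ?_
    rw [slope_def_field] at hz
    rwa [inv_mul_eq_div]
  have hbound : ∀ x ∈ Ico 0 t, D x ≤ κ * E x + κ := by
    intro x hx
    have hxT : x ∈ Ico 0 T := ⟨hx.1, lt_trans hx.2 ht.2⟩
    have := hDle x hxT
    linarith [this]
  have hG := le_gronwallBound_of_liminf_deriv_right_le (δ := E 0) (K := κ) (ε := κ)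
    hcont hderiv le_rfl hbound t ⟨ht.1, le_rfl⟩
  rw [sub_zero] at hG
  -- evaluate the Grönwall bound
  rcases eq_or_ne κ 0 with hk | hk
  · subst hk
    simp [gronwallBound_K0] at hG
    simpa using hG
  · rw [gronwallBound_of_K_ne_0 hk] at hG
    have : E 0 * Real.exp (κ * t) + κ / κ * (Real.exp (κ * t) - 1)
        = (E 0 + 1) * Real.exp (κ * t) - 1 := by
      rw [div_self hk]; ring
    simpa [this] using hG

/-- **`Step_9` HOLDS** — (26) and the closing sentences p.6 l.32–49 at the TYPED bookkeeping grain: along a class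
solution on `[0,T)` (`Chae2007.IsLocalSolution`), a majorant `F` of `‖ω(·,t)‖_∞ = supVort u t` continuous on
`[0,T]` makes the tree-form BKM integral `∫⁻_{(0,T)} ⨆ₓ ‖curl u(t,x)‖ₑ` finite. Proof: at each `t ∈ [0,T)` the
class bound `exists_enorm_curl_le_of_hasBoundedSobolevNormsOn` (from `IsLocalSolution.sobolev t` and the
classical smoothness of `u`) makes `⨆ₓ ‖curl u(t,x)‖ₑ` finite, hence `= ENNReal.ofReal (supVort u t) ≤
ENNReal.ofReal (F t)`; then monotonicity of the lower integral, `(0,T) ⊆ [0,T]`, and integrability of the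
continuous `F` on the compact `[0,T]`. Summits-side twin (same statement, proved first): `Summit.NavierStokesRegularity.
NavierStokesRegularity.Theorems.Permana2026Salvage.step_9_holds` (Theorems/SoloSalvagePermana2026.lean) — restated
here because `Literature` may not import `Summits`; this in-file copy is what retires the named fact `Step_9`.
[cite: Permana2026, (26) p.6 l.32–49] -/
theorem step_9_holds : Step_9 := by
  intro ν _hν T _hT v₀ u p hsol F hFc hmaj
  -- pointwise in time: the vorticity sup is finite in the class, hence equals `ofReal (supVort u t)`
  have hfin : ∀ t ∈ Ico 0 T, (⨆ x, ‖curl (u t) x‖ₑ) ≤ ENNReal.ofReal (F t) := by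
    intro t ht
    obtain ⟨R, hRtop, hR⟩ := exists_enorm_curl_le_of_hasBoundedSobolevNormsOn
      (fun s hs => hsol.isClassical.contDiff_velocity ⟨hs.1, lt_of_le_of_lt hs.2 ht.2⟩) (hsol.sobolev t ht.2)
    have hle : (⨆ x, ‖curl (u t) x‖ₑ) ≤ R := iSup_le fun x => hR t ⟨ht.1, le_rfl⟩ x
    have hne : (⨆ x, ‖curl (u t) x‖ₑ) ≠ ⊤ := ne_top_of_le_ne_top hRtop.ne hle
    have heq : (⨆ x, ‖curl (u t) x‖ₑ) = ENNReal.ofReal (supVort u t) := by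
      rw [supVort, ENNReal.ofReal_toReal hne]
    rw [heq]
    exact ENNReal.ofReal_le_ofReal (hmaj t ht)
  -- integrate the continuous majorant over the compact interval `[0,T]`
  have hint : IntegrableOn F (Icc 0 T) volume := hFc.integrableOn_Icc
  calc (∫⁻ t in Ioo 0 T, ⨆ x, ‖curl (u t) x‖ₑ)
      ≤ ∫⁻ t in Ioo 0 T, ENNReal.ofReal (F t) :=
        setLIntegral_mono' measurableSet_Ioo fun t ht => hfin t ⟨ht.1.le, ht.2⟩
    _ ≤ ∫⁻ t in Icc 0 T, ENNReal.ofReal (F t) := lintegral_mono_set Ioo_subset_Icc_self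
    _ ≤ ∫⁻ t in Icc 0 T, ‖F t‖ₑ := lintegral_mono fun t => Real.ofReal_le_enorm (F t)
    _ < ⊤ := hint.2


/-! ### Rev 6 (typist-11 g7, records-grade, APPEND-ONLY): the two C17-reuse binders discharged BY NAME in-file

`Step_1` and `Step_2` are `Chae2007.Step_1` / `Chae2007.Step_2` by definition (REUSED BY NAME above) and are
DISCHARGED in `Literature/Claims/NS/Chae2007.lean` (`Chae2007.step_1_holds` via
`Literature.Analysis.FluidPDE.exists_global_bkmClass_or_blowup`; `Chae2007.step_2_holds` =
`MajdaBertozzi2002_bkmAprioriH3_holds`). The one-line in-file certificates below retire the named facts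
`Permana2026.Step_1` / `Permana2026.Step_2` of this skeleton (DEBT-LEDGER row `Permana2026`); nothing disputed is
asserted, the located step `Step_3` and every other declaration are untouched. -/

/-- **Step 1 of C119 holds** (the maximal-time dichotomy in the BKM class, §6 p.5 l.51–52; = `Chae2007.Step_1`,
DISCHARGED there for every `ν ≥ 0`). [cite: Permana2026, §6 p.5 l.51–52] -/
theorem step_1_holds : Step_1 :=
  Chae2007.step_1_holds

/-- **Step 2 of C119 holds** (the Beale–Kato–Majda criterion [11] as invoked, §6 p.5 l.51–58; = `Chae2007.Step_2`
= `MajdaBertozzi2002_bkmAprioriH3`, DISCHARGED). [cite: Permana2026, §6 p.5 l.51–58] -/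
theorem step_2_holds : Step_2 :=
  Chae2007.step_2_holds

/-- With Steps 1, 2, 5, 6, 9 discharged in-file, the printed chain reduces to its four live binders: the located
`Step_3` (Lemma 3.1 (7), unfilled gap of record #126), the enstrophy identity `Step_4` (TRUE; Summits-side
`…Theorems.Permana2026Salvage.step_4_holds`), and the §6.2 displays `Step_7` (24) / `Step_8` (25) (`Step_8` REFUTED
Summits-side, `…Theorems.Permana2026.not_Step_8`). Pure bookkeeping over `claim_of_steps`.
[cite: Permana2026, §6 pp.5–6] -/
theorem claim_of_live_steps (h3 : Step_3) (h4 : Step_4) (h7 : Step_7) (h8 : Step_8) : ClaimedTheorem :=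
  claim_of_steps step_1_holds step_2_holds h3 h4 step_5_holds step_6_holds h7 h8 step_9_holds

end Literature.Claims.NS.Permana2026
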